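import Mathlib.Analysis.SpecialFunctions.Exp
import Mathlib.Analysis.SpecialFunctions.Pow.Real
import Mathlib.Analysis.Normed.Ring.InfiniteSum
import Mathlib.Analysis.SpecificLimits.Basic
import Mathlib.Analysis.Complex.ExponentialBounds
import HarnessLib

/-!
# Laplace series `∑ aₙ e^{-nt}`: an Abelian estimate from the average of the convolution square

Support file (elementary real analysis) for the converse direction of Granville's theorem
`RH ↔ ∑_{N ≤ x, N even} (G(N) − J(N)) ≪ x^{3/2+o(1)}` (`Literature.NumberTheory.Sieve.granville_thm1A`,
A. Granville, Funct. Approx. Comment. Math. 37 (2007), Thm. 1A) in the form completed by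
G. Bhowmik and I. Z. Ruzsa, *Average Goldbach and the quasi-Riemann hypothesis*, Anal. Math.
44 (2018), 51–56, Thm. 2.1 and its proof ("the power series step"):

for a non-negative sequence `a` with `aₙ ≤ n + 1`, the Laplace series
`F(t) = ∑ aₙ e^{-nt}` (`laplaceSeries`), the convolution square `(a ⋆ a)(n) = ∑_{i+j=n} aᵢ aⱼ`
(`selfConv`) and its summatory function `S(n) = ∑_{m ≤ n} (a ⋆ a)(m)` (`selfConvSum`) satisfy

* `laplaceSeries_sq`: `F(t)² = (1 − e^{-t}) ∑ S(n) e^{-nt}` (Bhowmik–Ruzsa, proof of Thm. 2.1: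
  "`F(z)² = (1 − z) ∑ S(n) zⁿ`");
* `exists_abs_laplaceSeries_sub_inv_le` (**the Abelian estimate**): if
  `|S(n) − n²/2| ≤ C (n+1)^α` for all `n` (`1 ≤ α`), then `|F(t) − 1/t| ≤ C' t^{1−α}` for
  `0 < t ≤ 1` (Bhowmik–Ruzsa, proof of Thm. 2.1: `F(z) = 1/(1−z) + O(|1−z|^2 N^{3−δ})` on the
  major arc; we only need real `z = e^{-t}`, where the square root is taken using `F ≥ 0`).

Everything here is proved; the file introduces no named facts. It is used with `a = Λ` in
`Literature/NumberTheory/LFunctions/VonMangoldtLaplace.lean`.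

## References

* G. Bhowmik, I. Z. Ruzsa, *Average Goldbach and the quasi-Riemann hypothesis*, Anal. Math. 44
  (2018), no. 1, 51–56, Thm. 2.1 (proof, power-series step). doi:10.1007/s10476-018-0105-4
* A. Granville, *Refinements of Goldbach's conjecture, and the generalized Riemann hypothesis*,
  Funct. Approx. Comment. Math. 37 (2007), 159–173, Thm. 1A and (5.2).
-/

noncomputable section

open Finset Real

namespace Literature.NumberTheory.LFunctions

/-! ### Definitions -/

/-- The Laplace series (power series in `z = e^{-t}`) of a real sequence:
`laplaceSeries a t = ∑_{n ≥ 0} aₙ e^{-nt}` (Bhowmik–Ruzsa's `F(z) = ∑ Λ(n) zⁿ` at `z = e^{-t}` when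
`a = Λ`). A `tsum`, hence `0` by convention where the series diverges (never used: all uses have
`t > 0` and `|aₙ| ≤ n + 1`). [cite: BhowmikRuzsa2018, §2 proof of Thm. 2.1] -/
def laplaceSeries (a : ℕ → ℝ) (t : ℝ) : ℝ := ∑' n : ℕ, a n * exp (-t * n)

/-- The convolution square `(a ⋆ a)(n) = ∑_{i+j=n} aᵢ aⱼ` (for `a = Λ` this is Bhowmik–Ruzsa's
Goldbach function `G(n) = ∑_{k₁+k₂=n} Λ(k₁)Λ(k₂)`). [cite: BhowmikRuzsa2018, §1] -/
def selfConv (a : ℕ → ℝ) (n : ℕ) : ℝ := ∑ ij ∈ antidiagonal n, a ij.1 * a ij.2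

/-- The summatory function `S(n) = ∑_{m ≤ n} (a ⋆ a)(m)` of the convolution square
(Bhowmik–Ruzsa's `S(x) = ∑_{n ≤ x} G(n)` for `a = Λ`). [cite: BhowmikRuzsa2018, §1 (1)] -/
def selfConvSum (a : ℕ → ℝ) (n : ℕ) : ℝ := ∑ m ∈ range (n + 1), selfConv a m

variable {a : ℕ → ℝ}

/-- Unfolding lemma for `laplaceSeries`. [folklore] -/
theorem laplaceSeries_def (a : ℕ → ℝ) (t : ℝ) :
    laplaceSeries a t = ∑' n : ℕ, a n * exp (-t * n) := rfl

/-- Unfolding lemma for `selfConv`. [folklore] -/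
theorem selfConv_def (a : ℕ → ℝ) (n : ℕ) :
    selfConv a n = ∑ ij ∈ antidiagonal n, a ij.1 * a ij.2 := rfl

/-- Unfolding lemma for `selfConvSum`. [folklore] -/
theorem selfConvSum_def (a : ℕ → ℝ) (n : ℕ) :
    selfConvSum a n = ∑ m ∈ range (n + 1), selfConv a m := rfl

/-! ### Weighted geometric series -/

/-- `exp (-t n) = (exp (-t))ⁿ`. [folklore] -/
theorem exp_neg_mul_natCast (t : ℝ) (n : ℕ) : exp (-t * n) = exp (-t) ^ n := by
  rw [mul_comm, exp_nat_mul]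

/-- For `t > 0` and `k : ℕ`, `∑ (n+1)^k e^{-tn}` converges. [folklore] -/
theorem summable_pow_succ_mul_exp {t : ℝ} (ht : 0 < t) (k : ℕ) :
    Summable fun n : ℕ ↦ ((n : ℝ) + 1) ^ k * exp (-t * n) := by
  have h := ((summable_nat_add_iff 1).mpr (summable_pow_mul_exp_neg_nat_mul k ht)).mul_left
    (exp t)
  refine h.congr fun n ↦ ?_
  push_cast
  rw [show -t * ((n : ℝ) + 1) = -t * n + -t by ring, exp_add, show -t = -(t : ℝ) by rfl,
    exp_neg t]
  field_simp

/-- A sequence with `|bₙ| ≤ B (n+1)^k` has an absolutely convergent Laplace series for `t > 0`.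
[folklore] -/
theorem summable_abs_mul_exp_of_le {b : ℕ → ℝ} {B : ℝ} {k : ℕ}
    (hb : ∀ n, |b n| ≤ B * ((n : ℝ) + 1) ^ k) {t : ℝ} (ht : 0 < t) :
    Summable fun n : ℕ ↦ ‖b n * exp (-t * n)‖ := by
  refine Summable.of_nonneg_of_le (fun n ↦ norm_nonneg _) (fun n ↦ ?_)
    ((summable_pow_succ_mul_exp ht k).mul_left B)
  rw [norm_mul, norm_eq_abs, norm_eq_abs, abs_of_pos (exp_pos _), ← mul_assoc]
  exact mul_le_mul_of_nonneg_right (hb n) (exp_pos _).le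

/-- `v^α e^{-v} ≤ ⌈α⌉!` for `v ≥ 0`, `α ≥ 0` (from `vⁿ/n! ≤ eᵛ`). [folklore] -/
theorem rpow_mul_exp_neg_le_factorial {α : ℝ} (hα : 0 ≤ α) {v : ℝ} (hv : 0 ≤ v) :
    v ^ α * exp (-v) ≤ (⌈α⌉₊.factorial : ℝ) := by
  have hfac : (1 : ℝ) ≤ ⌈α⌉₊.factorial := by exact_mod_cast Nat.one_le_iff_ne_zero.mpr (Nat.factorial_ne_zero _)
  rcases le_or_gt v 1 with hv1 | hv1
  · calc v ^ α * exp (-v) ≤ 1 * 1 :=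
          mul_le_mul (rpow_le_one hv hv1 hα) (by rw [exp_le_one_iff]; linarith) (exp_pos _).le
            zero_le_one
      _ ≤ _ := by rw [mul_one]; exact hfac
  · have h1 : v ^ α ≤ v ^ (⌈α⌉₊ : ℝ) := rpow_le_rpow_of_exponent_le hv1.le (Nat.le_ceil α)
    rw [rpow_natCast] at h1
    have h2 := pow_div_factorial_le_exp v hv ⌈α⌉₊
    rw [div_le_iff₀ (by positivity)] at h2
    rw [← le_div_iff₀ (exp_pos _), div_eq_mul_inv, ← exp_neg, neg_neg]
    exact h1.trans (h2.trans_eq (mul_comm _ _))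

/-- The constant `K(α) = 8 · 2^α · ⌈α⌉!` of the weighted geometric bound. [folklore] -/
def geomWeightConst (α : ℝ) : ℝ := 8 * 2 ^ α * (⌈α⌉₊.factorial : ℝ)

/-- `K(α) ≥ 0`. [folklore] -/
theorem geomWeightConst_nonneg (α : ℝ) : 0 ≤ geomWeightConst α := by
  unfold geomWeightConst; positivity

/-- Termwise bound: for `0 < t ≤ 1`, `(n+1)^α e^{-tn} ≤ 2 · 2^α ⌈α⌉! · t^{-α} · e^{-(t/2) n}`.
[folklore] -/
theorem pow_succ_rpow_mul_exp_le {α : ℝ} (hα : 0 ≤ α) {t : ℝ} (ht : 0 < t) (ht1 : t ≤ 1) (n : ℕ) :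
    ((n : ℝ) + 1) ^ α * exp (-t * n) ≤
      2 * 2 ^ α * (⌈α⌉₊.factorial : ℝ) * t ^ (-α) * exp (-(t / 2) * n) := by
  have hn : (0 : ℝ) ≤ (n : ℝ) + 1 := by positivity
  set v : ℝ := t / 2 * ((n : ℝ) + 1) with hv
  have hv0 : 0 ≤ v := by positivity
  have hkey := rpow_mul_exp_neg_le_factorial hα hv0
  -- `(n+1)^α = (2/t)^α v^α`
  have hsplit : ((n : ℝ) + 1) ^ α = (2 / t) ^ α * v ^ α := by
    rw [← mul_rpow (by positivity) hv0, hv]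
    congr 1
    field_simp
  have h2t : (2 / t) ^ α = 2 ^ α * t ^ (-α) := by
    rw [div_rpow zero_le_two ht.le, rpow_neg ht.le, div_eq_mul_inv]
  -- `e^{-tn} = e^{-v} · e^{t/2} · e^{-(t/2) n}`
  have hexp : exp (-t * n) = exp (-v) * exp (t / 2) * exp (-(t / 2) * n) := by
    rw [← exp_add, ← exp_add, hv]
    congr 1
    ring
  have he : exp (t / 2) ≤ 2 := by
    have h9 := Real.exp_one_lt_d9
    have h1 : exp (t / 2) ≤ exp (1 / 2) := exp_le_exp.mpr (by linarith)
    have h2 : exp (1 / 2) ^ 2 = exp 1 := by rw [← exp_nat_mul]; norm_num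
    have h3 : 0 < exp (1 / 2) := exp_pos _
    nlinarith
  calc ((n : ℝ) + 1) ^ α * exp (-t * n)
      = 2 ^ α * t ^ (-α) * (v ^ α * exp (-v)) * exp (t / 2) * exp (-(t / 2) * n) := by
        rw [hsplit, h2t, hexp]; ring
    _ ≤ 2 ^ α * t ^ (-α) * (⌈α⌉₊.factorial : ℝ) * 2 * exp (-(t / 2) * n) := by
        gcongr
    _ = 2 * 2 ^ α * (⌈α⌉₊.factorial : ℝ) * t ^ (-α) * exp (-(t / 2) * n) := by ring

/-- `∑ e^{-(t/2) n} ≤ 4/t` for `0 < t ≤ 1`. [folklore] -/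
theorem tsum_exp_neg_half_mul_le {t : ℝ} (ht : 0 < t) (ht1 : t ≤ 1) :
    ∑' n : ℕ, exp (-(t / 2) * n) = (1 - exp (-(t / 2)))⁻¹ ∧ (1 - exp (-(t / 2)))⁻¹ ≤ 4 / t := by
  have hr0 : 0 ≤ exp (-(t / 2)) := (exp_pos _).le
  have hr1 : exp (-(t / 2)) < 1 := exp_lt_one_iff.mpr (by linarith)
  constructor
  · simp_rw [exp_neg_mul_natCast]
    exact tsum_geometric_of_lt_one hr0 hr1
  · -- `1 - e^{-t/2} ≥ (t/2)/(1 + t/2) ≥ t/4`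
    have h1 : exp (-(t / 2)) ≤ 1 / (1 + t / 2) := by
      rw [exp_neg, le_div_iff₀ (by positivity), ← div_eq_inv_mul, div_le_one (exp_pos _)]
      linarith [add_one_le_exp (t / 2)]
    have h2 : t / 4 ≤ 1 - exp (-(t / 2)) := by
      have h3 : 1 - 1 / (1 + t / 2) = (t / 2) / (1 + t / 2) := by field_simp; ring
      have h4 : t / 4 ≤ (t / 2) / (1 + t / 2) := by
        rw [le_div_iff₀ (by positivity)]; nlinarith
      linarith
    rw [inv_eq_one_div, div_le_div_iff₀ (by linarith) ht]
    linarith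

/-- **Weighted geometric series.** For `α ≥ 0` and `0 < t ≤ 1`: `∑ (n+1)^α e^{-tn}` converges
and is `≤ K(α) t^{-(α+1)}` (the elementary bound `∑ n^{2−δ} |z|ⁿ ≪ (1 − |z|)^{δ−3}` of
Bhowmik–Ruzsa, proof of Thm. 2.1, at real `z = e^{-t}`). [cite: BhowmikRuzsa2018, §2 proof of Thm. 2.1] -/
theorem tsum_pow_succ_rpow_mul_exp_le {α : ℝ} (hα : 0 ≤ α) {t : ℝ} (ht : 0 < t) (ht1 : t ≤ 1) :
    Summable (fun n : ℕ ↦ ((n : ℝ) + 1) ^ α * exp (-t * n)) ∧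
      ∑' n : ℕ, ((n : ℝ) + 1) ^ α * exp (-t * n) ≤ geomWeightConst α * t ^ (-(α + 1)) := by
  obtain ⟨hgeom, hle⟩ := tsum_exp_neg_half_mul_le ht ht1
  have hsg : Summable fun n : ℕ ↦ exp (-(t / 2) * n) := by
    simp_rw [exp_neg_mul_natCast]
    exact summable_geometric_of_lt_one (exp_pos _).le (exp_lt_one_iff.mpr (by linarith))
  set M : ℝ := 2 * 2 ^ α * (⌈α⌉₊.factorial : ℝ) * t ^ (-α) with hM
  have hM0 : 0 ≤ M := by positivity
  have hterm := pow_succ_rpow_mul_exp_le hα ht ht1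
  have hS : Summable fun n : ℕ ↦ ((n : ℝ) + 1) ^ α * exp (-t * n) :=
    Summable.of_nonneg_of_le (fun n ↦ by positivity) hterm (hsg.mul_left M)
  refine ⟨hS, ?_⟩
  calc ∑' n : ℕ, ((n : ℝ) + 1) ^ α * exp (-t * n)
      ≤ ∑' n : ℕ, M * exp (-(t / 2) * n) := hS.tsum_le_tsum hterm (hsg.mul_left M)
    _ = M * (1 - exp (-(t / 2)))⁻¹ := by rw [tsum_mul_left, hgeom]
    _ ≤ M * (4 / t) := by gcongr
    _ = geomWeightConst α * t ^ (-(α + 1)) := by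
        rw [hM, geomWeightConst, neg_add, rpow_add ht, rpow_neg_one]
        field_simp
        ring

/-! ### The identity `F(t)² = (1 − e^{-t}) ∑ S(n) e^{-nt}` -/

/-- `|(a ⋆ a)(n)| ≤ B² (n+1)^{2k+1}` when `|aₙ| ≤ B (n+1)^k`. [folklore] -/
theorem abs_selfConv_le {B : ℝ} {k : ℕ} (hB : 0 ≤ B) (hb : ∀ n, |a n| ≤ B * ((n : ℝ) + 1) ^ k)
    (n : ℕ) : |selfConv a n| ≤ B ^ 2 * ((n : ℝ) + 1) ^ (2 * k + 1) := by
  unfold selfConv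
  have hterm : ∀ ij ∈ antidiagonal n, |a ij.1 * a ij.2| ≤ B ^ 2 * ((n : ℝ) + 1) ^ (2 * k) := by
    intro ij hij
    rw [mem_antidiagonal] at hij
    have hi : (ij.1 : ℝ) + 1 ≤ n + 1 := by exact_mod_cast Nat.succ_le_succ (hij ▸ Nat.le_add_right _ _)
    have hj : (ij.2 : ℝ) + 1 ≤ n + 1 := by exact_mod_cast Nat.succ_le_succ (hij ▸ Nat.le_add_left _ _)
    rw [abs_mul]
    calc |a ij.1| * |a ij.2| ≤ (B * ((ij.1 : ℝ) + 1) ^ k) * (B * ((ij.2 : ℝ) + 1) ^ k) :=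
          mul_le_mul (hb _) (hb _) (abs_nonneg _) (by positivity)
      _ ≤ (B * ((n : ℝ) + 1) ^ k) * (B * ((n : ℝ) + 1) ^ k) := by gcongr
      _ = B ^ 2 * ((n : ℝ) + 1) ^ (2 * k) := by ring
  calc |∑ ij ∈ antidiagonal n, a ij.1 * a ij.2| ≤ ∑ ij ∈ antidiagonal n, |a ij.1 * a ij.2| :=
        abs_sum_le_sum_abs _ _
    _ ≤ ∑ ij ∈ antidiagonal n, B ^ 2 * ((n : ℝ) + 1) ^ (2 * k) := sum_le_sum hterm
    _ = B ^ 2 * ((n : ℝ) + 1) ^ (2 * k + 1) := by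
        rw [sum_const, Nat.card_antidiagonal, nsmul_eq_mul]; push_cast; ring

/-- `|S(n)| ≤ B² (n+1)^{2k+2}` when `|aₙ| ≤ B (n+1)^k`. [folklore] -/
theorem abs_selfConvSum_le {B : ℝ} {k : ℕ} (hB : 0 ≤ B) (hb : ∀ n, |a n| ≤ B * ((n : ℝ) + 1) ^ k)
    (n : ℕ) : |selfConvSum a n| ≤ B ^ 2 * ((n : ℝ) + 1) ^ (2 * k + 2) := by
  unfold selfConvSum
  calc |∑ m ∈ range (n + 1), selfConv a m| ≤ ∑ m ∈ range (n + 1), |selfConv a m| :=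
        abs_sum_le_sum_abs _ _
    _ ≤ ∑ m ∈ range (n + 1), B ^ 2 * ((n : ℝ) + 1) ^ (2 * k + 1) := by
        refine sum_le_sum fun m hm ↦ (abs_selfConv_le hB hb m).trans ?_
        have : (m : ℝ) + 1 ≤ n + 1 := by exact_mod_cast Nat.succ_le_of_lt (mem_range.mp hm)
        gcongr
    _ = B ^ 2 * ((n : ℝ) + 1) ^ (2 * k + 2) := by
        rw [sum_const, card_range, nsmul_eq_mul]; push_cast; ring

/-- Cauchy product of two Laplace series: `(∑ bₙ e^{-nt})(∑ cₙ e^{-nt}) = ∑ₙ (∑_{i+j=n} bᵢ cⱼ) e^{-nt}`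
for absolutely convergent series. [folklore] -/
theorem tsum_mul_exp_mul_tsum_mul_exp {b c : ℕ → ℝ} {t : ℝ}
    (hb : Summable fun n : ℕ ↦ ‖b n * exp (-t * n)‖) (hc : Summable fun n : ℕ ↦ ‖c n * exp (-t * n)‖) :
    (∑' n : ℕ, b n * exp (-t * n)) * (∑' n : ℕ, c n * exp (-t * n)) =
      ∑' n : ℕ, (∑ ij ∈ antidiagonal n, b ij.1 * c ij.2) * exp (-t * n) := by
  rw [tsum_mul_tsum_eq_tsum_sum_antidiagonal_of_summable_norm hb hc]
  refine tsum_congr fun n ↦ ?_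
  rw [sum_mul]
  refine sum_congr rfl fun ij hij ↦ ?_
  rw [mem_antidiagonal] at hij
  have : exp (-t * ij.1) * exp (-t * ij.2) = exp (-t * n) := by
    rw [← exp_add, ← hij]; push_cast; ring_nf
  rw [← this]; ring

/-- **`F(t)² = (1 − e^{-t}) ∑ S(n) e^{-nt}`** for `t > 0` and `|aₙ| ≤ B (n+1)^k`: square the
Laplace series (Cauchy product, giving `∑ (a ⋆ a)(n) e^{-nt}`) and sum by parts against the
geometric series (Bhowmik–Ruzsa, proof of Thm. 2.1: "writing `G(n) = S(n) − S(n−1)` we get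
`F(z)² = (1 − z) ∑ S(n) zⁿ`"). [cite: BhowmikRuzsa2018, §2 proof of Thm. 2.1] -/
theorem laplaceSeries_sq {B : ℝ} {k : ℕ} (hB : 0 ≤ B) (hb : ∀ n, |a n| ≤ B * ((n : ℝ) + 1) ^ k)
    {t : ℝ} (ht : 0 < t) :
    Summable (fun n : ℕ ↦ selfConvSum a n * exp (-t * n)) ∧
      laplaceSeries a t ^ 2 = (1 - exp (-t)) * ∑' n : ℕ, selfConvSum a n * exp (-t * n) := by
  have hr0 : 0 ≤ exp (-t) := (exp_pos _).le
  have hr1 : exp (-t) < 1 := exp_lt_one_iff.mpr (by linarith)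
  have ha_s := summable_abs_mul_exp_of_le hb ht
  have hconv_s : Summable fun n : ℕ ↦ ‖selfConv a n * exp (-t * n)‖ :=
    summable_abs_mul_exp_of_le (B := B ^ 2) (k := 2 * k + 1) (abs_selfConv_le hB hb) ht
  have hS_s : Summable fun n : ℕ ↦ ‖selfConvSum a n * exp (-t * n)‖ :=
    summable_abs_mul_exp_of_le (B := B ^ 2) (k := 2 * k + 2) (abs_selfConvSum_le hB hb) ht
  have hgeom_s : Summable fun n : ℕ ↦ ‖(1 : ℝ) * exp (-t * n)‖ := by
    refine summable_abs_mul_exp_of_le (B := 1) (k := 0) (fun n ↦ ?_) ht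
    simp
  refine ⟨hS_s.of_norm, ?_⟩
  -- the square
  have hsq : laplaceSeries a t ^ 2 = ∑' n : ℕ, selfConv a n * exp (-t * n) := by
    rw [sq, laplaceSeries_def, tsum_mul_exp_mul_tsum_mul_exp ha_s ha_s]
    rfl
  -- summation by parts against the geometric series
  have hgeom : ∑' n : ℕ, (1 : ℝ) * exp (-t * n) = (1 - exp (-t))⁻¹ := by
    simp_rw [one_mul, exp_neg_mul_natCast]
    exact tsum_geometric_of_lt_one hr0 hr1
  have hparts : (∑' n : ℕ, selfConv a n * exp (-t * n)) * (1 - exp (-t))⁻¹ =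
      ∑' n : ℕ, selfConvSum a n * exp (-t * n) := by
    rw [← hgeom, tsum_mul_exp_mul_tsum_mul_exp hconv_s hgeom_s]
    refine tsum_congr fun n ↦ ?_
    congr 1
    rw [selfConvSum_def, Nat.sum_antidiagonal_eq_sum_range_succ (fun i _ ↦ selfConv a i * 1) n]
    simp
  have hq : (1 - exp (-t)) ≠ 0 := by linarith
  rw [hsq, ← hparts]
  field_simp

/-! ### The comparison series `aₙ = 1` -/

/-- `∑ e^{-nt} = (1 − e^{-t})⁻¹` for `t > 0`. [folklore] -/
theorem laplaceSeries_one {t : ℝ} (ht : 0 < t) : laplaceSeries (fun _ ↦ 1) t = (1 - exp (-t))⁻¹ := by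
  rw [laplaceSeries_def]
  simp_rw [one_mul, exp_neg_mul_natCast]
  exact tsum_geometric_of_lt_one (exp_pos _).le (exp_lt_one_iff.mpr (by linarith))

/-- `(1 ⋆ 1)(n) = n + 1`. [folklore] -/
theorem selfConv_one (n : ℕ) : selfConv (fun _ ↦ (1 : ℝ)) n = n + 1 := by
  rw [selfConv_def]
  simp [Nat.card_antidiagonal]

/-- `∑_{m ≤ n} (m + 1) = (n+1)(n+2)/2`. [folklore] -/
theorem selfConvSum_one (n : ℕ) : selfConvSum (fun _ ↦ (1 : ℝ)) n = ((n : ℝ) + 1) * ((n : ℝ) + 2) / 2 := by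
  rw [selfConvSum_def]
  simp_rw [selfConv_one]
  induction n with
  | zero => simp
  | succ n ih => rw [sum_range_succ, ih]; push_cast; ring

/-- `|∑_{m ≤ n}(m+1) − n²/2| ≤ 2 (n+1)`. [folklore] -/
theorem abs_selfConvSum_one_sub_le (n : ℕ) :
    |selfConvSum (fun _ ↦ (1 : ℝ)) n - (n : ℝ) ^ 2 / 2| ≤ 2 * ((n : ℝ) + 1) := by
  rw [selfConvSum_one]
  have hn : (0 : ℝ) ≤ n := n.cast_nonneg
  rw [abs_of_nonneg (by nlinarith)]
  nlinarith

/-! ### The Abelian estimate -/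

/-- Elementary facts about `q = 1 − e^{-t}` for `0 < t ≤ 1`: `t/2 ≤ q ≤ t` and `t − q ≤ t²`.
[folklore] -/
theorem one_sub_exp_neg_bounds {t : ℝ} (ht : 0 < t) (ht1 : t ≤ 1) :
    t / 2 ≤ 1 - exp (-t) ∧ 1 - exp (-t) ≤ t ∧ t - (1 - exp (-t)) ≤ t ^ 2 := by
  have h1 : exp (-t) ≤ 1 / (1 + t) := by
    rw [exp_neg, le_div_iff₀ (by positivity), ← div_eq_inv_mul, div_le_one (exp_pos _)]
    linarith [add_one_le_exp t]
  have h2 : 1 - 1 / (1 + t) = t / (1 + t) := by field_simp; ring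
  have h3 : t / 2 ≤ t / (1 + t) := by rw [div_le_div_iff₀ (by norm_num) (by positivity)]; nlinarith
  have h4 : t - t / (1 + t) ≤ t ^ 2 := by
    rw [show t - t / (1 + t) = t ^ 2 / (1 + t) by field_simp; ring, div_le_iff₀ (by positivity)]
    nlinarith
  refine ⟨by linarith, by linarith [one_sub_le_exp_neg t], by linarith⟩

/-- The Laplace series of a non-negative sequence is non-negative. [folklore] -/
theorem laplaceSeries_nonneg (ha0 : ∀ n, 0 ≤ a n) (t : ℝ) : 0 ≤ laplaceSeries a t :=
  tsum_nonneg fun n ↦ mul_nonneg (ha0 n) (exp_pos _).le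

/-- **The Abelian estimate** (Bhowmik–Ruzsa, proof of Thm. 2.1, power-series step, at real
`z = e^{-t}`). Let `0 ≤ aₙ ≤ n + 1` and suppose `|S(n) − n²/2| ≤ C (n+1)^α` for all `n`, where
`S(n) = ∑_{m ≤ n} (a ⋆ a)(m)` and `α ≥ 1`. Then there is `C'` with
`|∑ aₙ e^{-nt} − 1/t| ≤ C' t^{1−α}` for all `0 < t ≤ 1`.
Proof: with `q = 1 − e^{-t}`, `F² − q^{-2} = q ∑ (S(n) − S₁(n)) e^{-nt}` where
`S₁(n) = (n+1)(n+2)/2` is the summatory convolution square of the constant sequence `1`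
(`laplaceSeries_sq` twice); the weighted geometric bound gives `|q²F² − 1| ≪ t^{2−α}`, and since
`qF ≥ 0`, `|qF − 1| ≤ |q²F² − 1|`; finally `|1/q − 1/t| ≤ 2`.
[cite: BhowmikRuzsa2018, §2 proof of Thm. 2.1] -/
theorem exists_abs_laplaceSeries_sub_inv_le (ha0 : ∀ n, 0 ≤ a n) (ha : ∀ n, a n ≤ (n : ℝ) + 1)
    {C α : ℝ} (hα : 1 ≤ α) (hS : ∀ n, |selfConvSum a n - (n : ℝ) ^ 2 / 2| ≤ C * ((n : ℝ) + 1) ^ α) :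
    ∃ C', ∀ t, 0 < t → t ≤ 1 → |laplaceSeries a t - 1 / t| ≤ C' * t ^ (1 - α) := by
  have hC : 0 ≤ C := by
    have := (abs_nonneg _).trans (hS 0)
    simpa using this
  have hα0 : 0 ≤ α := by linarith
  set K := geomWeightConst α with hK
  have hK0 : 0 ≤ K := geomWeightConst_nonneg α
  refine ⟨2 * (C + 2) * K + 2, fun t ht ht1 ↦ ?_⟩
  obtain ⟨hq1, hq2, hq3⟩ := one_sub_exp_neg_bounds ht ht1
  set q : ℝ := 1 - exp (-t) with hq
  have hq0 : 0 < q := by linarith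
  set P := laplaceSeries a t with hP
  have hP0 : 0 ≤ P := laplaceSeries_nonneg ha0 t
  -- bounds `|aₙ| ≤ 1 · (n+1)^1`, `|1| ≤ 1 · (n+1)^0`
  have hb : ∀ n, |a n| ≤ 1 * ((n : ℝ) + 1) ^ 1 := fun n ↦ by
    rw [abs_of_nonneg (ha0 n), one_mul, pow_one]; exact ha n
  have hb1 : ∀ n : ℕ, |(1 : ℝ)| ≤ 1 * ((n : ℝ) + 1) ^ 0 := fun n ↦ by simp
  obtain ⟨hSa, hKa⟩ := laplaceSeries_sq zero_le_one hb ht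
  obtain ⟨hS1, hK1⟩ := laplaceSeries_sq zero_le_one hb1 ht
  rw [laplaceSeries_one ht] at hK1
  obtain ⟨hWs, hW⟩ := tsum_pow_succ_rpow_mul_exp_le hα0 ht ht1
  -- the difference of the two summatory functions
  have hdiff : ∀ n, |selfConvSum a n - selfConvSum (fun _ ↦ 1) n| ≤ (C + 2) * ((n : ℝ) + 1) ^ α := by
    intro n
    have h1 := hS n
    have h2 := abs_selfConvSum_one_sub_le n
    have h3 : (n : ℝ) + 1 ≤ ((n : ℝ) + 1) ^ α := by
      calc (n : ℝ) + 1 = ((n : ℝ) + 1) ^ (1 : ℝ) := (rpow_one _).symm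
        _ ≤ ((n : ℝ) + 1) ^ α := rpow_le_rpow_of_exponent_le (by linarith [n.cast_nonneg (α := ℝ)]) hα
    calc |selfConvSum a n - selfConvSum (fun _ ↦ 1) n|
        = |(selfConvSum a n - (n : ℝ) ^ 2 / 2) - (selfConvSum (fun _ ↦ 1) n - (n : ℝ) ^ 2 / 2)| := by
          ring_nf
      _ ≤ |selfConvSum a n - (n : ℝ) ^ 2 / 2| + |selfConvSum (fun _ ↦ 1) n - (n : ℝ) ^ 2 / 2| :=
          abs_sub _ _
      _ ≤ C * ((n : ℝ) + 1) ^ α + 2 * ((n : ℝ) + 1) := add_le_add h1 h2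
      _ ≤ C * ((n : ℝ) + 1) ^ α + 2 * ((n : ℝ) + 1) ^ α := by gcongr
      _ = (C + 2) * ((n : ℝ) + 1) ^ α := by ring
  -- `P² − 1/q² = q · D`
  set D : ℝ := ∑' n : ℕ, (selfConvSum a n - selfConvSum (fun _ ↦ 1) n) * exp (-t * n) with hD
  have hD_eq : P ^ 2 - q⁻¹ ^ 2 = q * D := by
    rw [hKa, hK1, hD, ← mul_sub, ← hSa.tsum_sub hS1]
    congr 1
    exact tsum_congr fun n ↦ by ring
  have hDs : Summable fun n : ℕ ↦ ‖(selfConvSum a n - selfConvSum (fun _ ↦ 1) n) * exp (-t * n)‖ := by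
    refine Summable.of_nonneg_of_le (fun n ↦ norm_nonneg _) (fun n ↦ ?_) (hWs.mul_left (C + 2))
    rw [norm_mul, norm_eq_abs, norm_eq_abs, abs_of_pos (exp_pos _), ← mul_assoc]
    exact mul_le_mul_of_nonneg_right (hdiff n) (exp_pos _).le
  have hD_le : |D| ≤ (C + 2) * K * t ^ (-α) * t⁻¹ := by
    calc |D| ≤ ∑' n : ℕ, ‖(selfConvSum a n - selfConvSum (fun _ ↦ 1) n) * exp (-t * n)‖ := by
          rw [← norm_eq_abs]; exact norm_tsum_le_tsum_norm hDs
      _ ≤ ∑' n : ℕ, (C + 2) * (((n : ℝ) + 1) ^ α * exp (-t * n)) := by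
          refine hDs.tsum_le_tsum (fun n ↦ ?_) (hWs.mul_left (C + 2))
          rw [norm_mul, norm_eq_abs, norm_eq_abs, abs_of_pos (exp_pos _), ← mul_assoc]
          exact mul_le_mul_of_nonneg_right (hdiff n) (exp_pos _).le
      _ = (C + 2) * ∑' n : ℕ, ((n : ℝ) + 1) ^ α * exp (-t * n) := tsum_mul_left
      _ ≤ (C + 2) * (K * t ^ (-(α + 1))) := by gcongr
      _ = (C + 2) * K * t ^ (-α) * t⁻¹ := by
          rw [neg_add, rpow_add ht, rpow_neg_one]; ring
  -- `|q² P² − 1| ≤ (C+2) K t^{2−α}`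
  have htα : t ^ (2 : ℝ) * t ^ (-α) = t ^ (2 - α) := by rw [← rpow_add ht]; ring_nf
  have hsq_le : |(q * P) ^ 2 - 1| ≤ (C + 2) * K * t ^ (2 - α) := by
    have : (q * P) ^ 2 - 1 = q ^ 2 * (q * D) := by
      rw [← hD_eq]; field_simp
    rw [this, abs_mul, abs_mul, abs_of_pos hq0, abs_of_pos (pow_pos hq0 2)]
    calc q ^ 2 * (q * |D|) ≤ t ^ 2 * (t * ((C + 2) * K * t ^ (-α) * t⁻¹)) := by
          gcongr
      _ = (C + 2) * K * (t ^ (2 : ℝ) * t ^ (-α)) := by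
          rw [rpow_two]; field_simp
      _ = (C + 2) * K * t ^ (2 - α) := by rw [htα]
  -- `|qP − 1| ≤ |q²P² − 1|`
  have hlin : |q * P - 1| ≤ (C + 2) * K * t ^ (2 - α) := by
    refine le_trans ?_ hsq_le
    have h1 : 1 ≤ q * P + 1 := by nlinarith [mul_nonneg hq0.le hP0]
    calc |q * P - 1| = |q * P - 1| * 1 := (mul_one _).symm
      _ ≤ |q * P - 1| * |q * P + 1| := by
          gcongr; rw [abs_of_pos (by linarith)]; exact h1
      _ = |(q * P) ^ 2 - 1| := by rw [← abs_mul]; ring_nf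
  -- `|P − 1/q| ≤ 2 (C+2) K t^{1−α}`
  have ht1α : t ^ (2 - α) / t = t ^ (1 - α) := by
    rw [div_eq_mul_inv, ← rpow_neg_one, ← rpow_add ht]; ring_nf
  have hmain : |P - q⁻¹| ≤ 2 * (C + 2) * K * t ^ (1 - α) := by
    have : P - q⁻¹ = (q * P - 1) / q := by field_simp
    rw [this, abs_div, abs_of_pos hq0, div_le_iff₀ hq0]
    calc |q * P - 1| ≤ (C + 2) * K * t ^ (2 - α) := hlin
      _ = (C + 2) * K * t ^ (1 - α) * t := by rw [← ht1α]; field_simp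
      _ ≤ (C + 2) * K * t ^ (1 - α) * (2 * q) := by gcongr; linarith
      _ = 2 * (C + 2) * K * t ^ (1 - α) * q := by ring
  -- `|1/q − 1/t| ≤ 2 ≤ 2 t^{1−α}`
  have hpow1 : 1 ≤ t ^ (1 - α) := one_le_rpow_of_pos_of_le_one_of_nonpos ht ht1 (by linarith)
  have hqt : |q⁻¹ - 1 / t| ≤ 2 := by
    have : q⁻¹ - 1 / t = (t - q) / (q * t) := by field_simp
    rw [this, abs_div, abs_of_pos (mul_pos hq0 ht), abs_of_nonneg (by linarith),
      div_le_iff₀ (mul_pos hq0 ht)]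
    nlinarith
  calc |P - 1 / t| = |(P - q⁻¹) + (q⁻¹ - 1 / t)| := by ring_nf
    _ ≤ |P - q⁻¹| + |q⁻¹ - 1 / t| := abs_add_le _ _
    _ ≤ 2 * (C + 2) * K * t ^ (1 - α) + 2 * t ^ (1 - α) := by
        refine add_le_add hmain (hqt.trans ?_); linarith
    _ = (2 * (C + 2) * K + 2) * t ^ (1 - α) := by ring

end Literature.NumberTheory.LFunctions

end
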